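import Summits.CriticalPhenomena.PercolationContinuityZ3.Theorems.PercNearOneGluingNoHeavyLowerTailSunflowerMultiPetalModuleCoStar
import HarnessLib
import HarnessLib.Audit

/-!
# `NoHeavyLowerTail` (crux stmt-CriticalPhenomena-4575), abstract sunflower cubic, `k` petals: 3-gadget blow-ups — the general MODEL transport and
# ★ₖ for every 2-THRESHOLD join of three gadgets (the tight family included)

Support file (seat `prim-l12-p2` gen 30; `--supports stmt-CriticalPhenomena-4575`; companion of `…SunflowerMultiPetalModuleCoStar` (`coef3`, `modUnion`, `memb`,
`glue_union_eq_modUnion`, `ZK_nonneg_of_coef3_nonneg`, the co-star case)).  Everything here is PROVED; no `sorry`, no named facts; the finite check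
(`coef3Thr2_nonneg`) is a kernel `decide`.  Memo: run/shared/lean/prim/prim-l12/prim-l12-p2/FINDING-g30-HOME-ROUTING.md §5 (Theorem C), §7.

* `IsQuotientModel F M₁ M₂ M₃ ml`: a model `ml : Bool³ → Fin 5` of the labels of the eight unions of the modules (top/bottom/equality charts);
  `coef3Model`, `IsQuotientModel.coef3_eq` (transport by `s6K_congr`), **`ZK_nonneg_of_isQuotientModel`**: ★ₖ for the blow-up once the model's 64 grouped
  coefficients are nonnegative (Conjecture G for the 3-point quotient as a finite check) — the API for further 3-point quotients.
* The 2-THRESHOLD rule (`IsThresholdTwoQuotient`: unions of ≥ 2 modules top, `∅` bottom, the single modules three distinct petals; model `mlThr2`):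
  `coef3Thr2_nonneg` (`decide`; in the gadget statistics `ZK = 6(a₂b₂c₂ + a₁b₂c₂ + a₂b₁c₂ + a₂b₂c₁)`), **`ZK_nonneg_of_isThresholdTwoQuotient`: ★ₖ for every
  2-threshold join of three arbitrary monotone gadgets** — three atoms / AND-blocks of any sizes (the TIGHT family `ZK = 0` of the census), three OR-blocks,
  majorities, …, with or without dummies (a dummy block can be merged into any module).
-/

namespace Summit.CriticalPhenomena.PercolationContinuityZ3.Theorems.SunflowerPartition

open Finset

variable {α : Type*} [DecidableEq α]

namespace MSunflower

variable {k : ℕ} (F : MSunflower k α)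

/-! ## A general model-transport and the 2-THRESHOLD rule (joins of three gadgets: black iff ≥ 2 modules, bottom iff none) -/

section Model

/-- A quotient MODEL on `Fin 5` for the labels of the eight unions of modules: `F.lab (modUnion b)` is top iff `ml b = 4`, bottom iff `ml b = 0`,
and two unions have equal labels iff their model labels agree. [this work] -/
structure IsQuotientModel (F : MSunflower k α) (M₁ M₂ M₃ : Finset α) (ml : Bool × Bool × Bool → Fin 5) : Prop where
  chart_top : ∀ b, F.lab (modUnion M₁ M₂ M₃ b) = Fin.last (k + 1) ↔ ml b = 4
  chart_bot : ∀ b, F.lab (modUnion M₁ M₂ M₃ b) = 0 ↔ ml b = 0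
  chart_eq : ∀ b b', F.lab (modUnion M₁ M₂ M₃ b) = F.lab (modUnion M₁ M₂ M₃ b') ↔ ml b = ml b'

/-- The grouped coefficients of a model. [this work] -/
def coef3Model (ml : Bool × Bool × Bool → Fin 5) (j : (ℕ × ℕ) × ℕ) : ℤ :=
  ∑ P ∈ (((univ : Finset (Finset (Fin 3))) ×ˢ (univ : Finset (Finset (Fin 3)))) ×ˢ (univ : Finset (Finset (Fin 3)))).filter
      (fun P => ((P.1.1.card, P.1.2.card), P.2.card) = j),
    s6K 3 (ml (memb P 0)) (ml (memb P 1)) (ml (memb P 2))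

variable {F} {M₁ M₂ M₃ : Finset α}

/-- Transport of the grouped coefficients to the model. [this work] -/
theorem IsQuotientModel.coef3_eq {ml : Bool × Bool × Bool → Fin 5} (h : F.IsQuotientModel M₁ M₂ M₃ ml) (j : (ℕ × ℕ) × ℕ) :
    F.coef3 M₁ M₂ M₃ j = coef3Model ml j := by
  unfold coef3 coef3Model
  refine sum_congr rfl fun P _ => ?_
  rw [glue_union_eq_modUnion, glue_union_eq_modUnion, glue_union_eq_modUnion]
  exact s6K_congr (h.chart_top _) (h.chart_bot _) (h.chart_top _) (h.chart_bot _) (h.chart_top _) (h.chart_bot _)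
    (h.chart_eq _ _) (h.chart_eq _ _) (h.chart_eq _ _)

/-- **★ₖ for a 3-gadget blow-up whose quotient has a model with nonnegative grouped coefficients** (Conjecture G for the 3-point quotient, as a
finite check on `Fin 5`). [this work] -/
theorem ZK_nonneg_of_isQuotientModel [Fintype α] {g₁ g₂ g₃ : Finset α → Bool} {ml : Bool × Bool × Bool → Fin 5}
    (h₁ : F.IsModule M₁ g₁) (h₂ : F.IsModule M₂ g₂) (h₃ : F.IsModule M₃ g₃)
    (d₁₂ : Disjoint M₁ M₂) (d₁₃ : Disjoint M₁ M₃) (d₂₃ : Disjoint M₂ M₃) (hcov : M₁ ∪ M₂ ∪ M₃ = univ)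
    (hq : F.IsQuotientModel M₁ M₂ M₃ ml) (hG : ∀ j ∈ ((range 4) ×ˢ (range 4)) ×ˢ (range 4), 0 ≤ coef3Model ml j) : 0 ≤ F.ZK :=
  F.ZK_nonneg_of_coef3_nonneg h₁ h₂ h₃ d₁₂ d₁₃ d₂₃ hcov fun j hj => by
    rw [hq.coef3_eq j]; exact hG j hj

end Model

/-! ## The 2-THRESHOLD rule: joins of three gadgets (top iff at least two modules, bottom iff none, three distinct petals for the single modules) -/

section ThresholdTwo

/-- The model labelling of the 2-threshold quotient: `4` (top) iff at least two modules, `0` (bottom) iff none, petals `1,2,3` for the singles. [this work] -/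
def mlThr2 : Bool × Bool × Bool → Fin 5
  | (false, false, false) => 0
  | (true, false, false) => 1
  | (false, true, false) => 2
  | (false, false, true) => 3
  | _ => 4

/-- The 2-THRESHOLD hypotheses on the quotient of `F` by three modules (e.g. the join of three atoms / AND-blocks — the TIGHT family `ZK = 0` — or of
three OR-blocks, majorities, …): every union of at least two modules is top, `∅` is bottom, and the single modules carry three pairwise distinct
petal labels. [this work] -/
structure IsThresholdTwoQuotient (F : MSunflower k α) (M₁ M₂ M₃ : Finset α) : Prop where
  top₁₂ : F.lab (M₁ ∪ M₂) = Fin.last (k + 1)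
  top₁₃ : F.lab (M₁ ∪ M₃) = Fin.last (k + 1)
  top₂₃ : F.lab (M₂ ∪ M₃) = Fin.last (k + 1)
  top_all : F.lab (M₁ ∪ M₂ ∪ M₃) = Fin.last (k + 1)
  bot_empty : F.lab ∅ = 0
  p₁_top : F.lab M₁ ≠ Fin.last (k + 1)
  p₁_bot : F.lab M₁ ≠ 0
  p₂_top : F.lab M₂ ≠ Fin.last (k + 1)
  p₂_bot : F.lab M₂ ≠ 0
  p₃_top : F.lab M₃ ≠ Fin.last (k + 1)
  p₃_bot : F.lab M₃ ≠ 0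
  ne₁₂ : F.lab M₁ ≠ F.lab M₂
  ne₁₃ : F.lab M₁ ≠ F.lab M₃
  ne₂₃ : F.lab M₂ ≠ F.lab M₃

variable {F} {M₁ M₂ M₃ : Finset α}

/-- The 2-threshold quotient has the model `mlThr2`. [this work] -/
theorem IsThresholdTwoQuotient.isQuotientModel (h : F.IsThresholdTwoQuotient M₁ M₂ M₃) : F.IsQuotientModel M₁ M₂ M₃ mlThr2 := by
  obtain ⟨t12, t13, t23, tall, h0, a1, a2, a3, a4, a5, a6, n1, n2, n3⟩ := h
  have l0 : (Fin.last (k + 1) : Fin (k + 2)) ≠ 0 := by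
    intro h; have := congrArg Fin.val h; simp at this
  have l0' : (0 : Fin (k + 2)) ≠ Fin.last (k + 1) := fun h => l0 h.symm
  have n1' : F.lab M₂ ≠ F.lab M₁ := fun h => n1 h.symm
  have n2' : F.lab M₃ ≠ F.lab M₁ := fun h => n2 h.symm
  have n3' : F.lab M₃ ≠ F.lab M₂ := fun h => n3 h.symm
  have a1' : Fin.last (k + 1) ≠ F.lab M₁ := fun h => a1 h.symm
  have a2' : (0 : Fin (k + 2)) ≠ F.lab M₁ := fun h => a2 h.symm
  have a3' : Fin.last (k + 1) ≠ F.lab M₂ := fun h => a3 h.symm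
  have a4' : (0 : Fin (k + 2)) ≠ F.lab M₂ := fun h => a4 h.symm
  have a5' : Fin.last (k + 1) ≠ F.lab M₃ := fun h => a5 h.symm
  have a6' : (0 : Fin (k + 2)) ≠ F.lab M₃ := fun h => a6 h.symm
  refine ⟨fun b => ?_, fun b => ?_, fun b b' => ?_⟩
  · rcases b with ⟨_ | _, _ | _, _ | _⟩ <;>
      simp only [modUnion, if_true, Bool.false_eq_true, if_false, empty_union, union_empty, mlThr2] <;>
      first
      | decide
      | simp_all
  · rcases b with ⟨_ | _, _ | _, _ | _⟩ <;>
      simp only [modUnion, if_true, Bool.false_eq_true, if_false, empty_union, union_empty, mlThr2] <;>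
      first
      | decide
      | simp_all
  · rcases b with ⟨_ | _, _ | _, _ | _⟩ <;> rcases b' with ⟨_ | _, _ | _, _ | _⟩ <;>
      simp only [modUnion, if_true, Bool.false_eq_true, if_false, empty_union, union_empty, mlThr2] <;>
      first
      | decide
      | simp_all

set_option maxRecDepth 200000 in
/-- The 64 grouped coefficients of the 2-threshold model are nonnegative (finite check; in fact `Z = 6(a₂b₂c₂ + a₁b₂c₂ + a₂b₁c₂ + a₂b₂c₁)`). [this work] -/
theorem coef3Thr2_nonneg : ∀ j ∈ ((range 4) ×ˢ (range 4)) ×ˢ (range 4), 0 ≤ coef3Model mlThr2 j := by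
  decide

/-- **★ₖ for every 2-threshold join of three arbitrary gadgets** (three atoms / AND-blocks = the tight family, three OR-blocks, majorities, …, of all
sizes, with or without dummies): `0 ≤ F.ZK`. [this work] -/
theorem ZK_nonneg_of_isThresholdTwoQuotient [Fintype α] {g₁ g₂ g₃ : Finset α → Bool}
    (h₁ : F.IsModule M₁ g₁) (h₂ : F.IsModule M₂ g₂) (h₃ : F.IsModule M₃ g₃)
    (d₁₂ : Disjoint M₁ M₂) (d₁₃ : Disjoint M₁ M₃) (d₂₃ : Disjoint M₂ M₃) (hcov : M₁ ∪ M₂ ∪ M₃ = univ)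
    (hq : F.IsThresholdTwoQuotient M₁ M₂ M₃) : 0 ≤ F.ZK :=
  ZK_nonneg_of_isQuotientModel h₁ h₂ h₃ d₁₂ d₁₃ d₂₃ hcov hq.isQuotientModel coef3Thr2_nonneg

end ThresholdTwo

end MSunflower

end Summit.CriticalPhenomena.PercolationContinuityZ3.Theorems.SunflowerPartition
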